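import Summits.CriticalPhenomena.PercolationContinuityZ3.Theorems.PercNearOneGluingNoHeavyLowerTailTieLocusInstances
import Summits.CriticalPhenomena.PercolationContinuityZ3.Theorems.PercNearOneGluingNoHeavyLowerTailWorstRelayGluing
import HarnessLib

/-!
# `NoHeavyLowerTail` (stmt-CriticalPhenomena-4575) — TIE REDUCTION for the worst-relay gluing (U₁) =
# Kozma–Nitzan Question 7

Support file (prover `prim-lf-8`, lemma factory "tie/glue-locus exclusion"; `--supports stmt-CriticalPhenomena-4575`).
No definitions, no named facts, no sorries.  Companion of `…TieLocusInstances` (event-level tie reduction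
`TieReduction.le_of_tied_events`, built on `prim-hp-8`'s `…TieLocusTools`).

(U₁) (`stub_worstRelayGluing`, = Kozma–Nitzan arXiv:2401.12397 Question 7): for a sink `c`, a finite set `A` and a
relay `a₁ ∈ A` MAXIMISING `μ(a ↮ c)` over `A`, `μ(o ↮ c, o ↔ A) ≤ μ(a₁ ↮ c, o ↔ A)`.  This is an inequality between
the probabilities of two fixed events at an extremal relay of the fixed score events `{a ↮ c}`, so:
* `worstRelayGluing_zeroOne`: it holds at 0/1 weights (if `o ↮ c` and `o ↔ a` then `a ↮ c`, so the maximal score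
  is `1` and `a₁ ↮ c`);
* `worstRelayGluing_of_tied`: (U₁) at least-reliable relays that are TIED with another relay ⇒ (U₁);
* `noHeavyLowerTail_of_tiedWorstRelayGluing`: hence the crux, through the landed
  `WorstRelayGluing.noHeavyLowerTail_of_worstRelayGluing`.
Reading: Kozma–Nitzan's Question 7 is equivalent to its restriction to instances in which the least `b`-reliable
relay is not unique.
-/

noncomputable section

namespace Summit.CriticalPhenomena.PercolationContinuityZ3.Theorems

open MeasureTheory Set Literature.Probability.LatticeModels Literature.Probability.Percolation
open scoped Classical BigOperators
open TieReduction

variable {n : ℕ}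

/-! ### (U₁) worst-relay gluing = Kozma–Nitzan Question 7 -/

/-- **Deterministic base for (U₁).**  At the carried configuration: if `o ↮ c` and `o ↔ a` for some `a ∈ A`, then
`a ↮ c`, so the most `c`-unreliable relay `a₁` is also cut from `c`. [folklore] -/
theorem worstRelayGluing_zeroOne (w : Sym2 (Fin n) → unitInterval)
    (hw : ∀ e, (w e : ℝ) = 0 ∨ (w e : ℝ) = 1) (A : Finset (Fin n)) (o c a₁ : Fin n)
    (hch : ∀ a ∈ A, (prodBernoulli w).real (openConn a c : Set (BondConfig (Fin n)))ᶜ ≤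
      (prodBernoulli w).real (openConn a₁ c : Set (BondConfig (Fin n)))ᶜ) :
    (prodBernoulli w).real ((openConn o c : Set (BondConfig (Fin n)))ᶜ ∩ ⋃ a ∈ A, openConn o a) ≤
      (prodBernoulli w).real ((openConn a₁ c : Set (BondConfig (Fin n)))ᶜ ∩ ⋃ a ∈ A, openConn o a) := by
  have hmeas : ∀ s : Set (BondConfig (Fin n)), MeasurableSet s := fun _ => MeasurableSet.of_discrete
  set ω₀ : BondConfig (Fin n) := {e | (w e : ℝ) = 1} with hω₀
  by_cases hX : ω₀ ∈ ((openConn o c : Set (BondConfig (Fin n)))ᶜ ∩ ⋃ a ∈ A, openConn o a)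
  · obtain ⟨hoc, hU⟩ := hX
    obtain ⟨a, ha, hoa⟩ : ∃ a ∈ A, ω₀ ∈ (openConn o a : Set (BondConfig (Fin n))) := by
      simpa only [Set.mem_iUnion, exists_prop] using hU
    have hac : ω₀ ∈ (openConn a c : Set (BondConfig (Fin n)))ᶜ := by
      intro hac
      exact hoc (show (openGraph ω₀).Reachable o c from
        (show (openGraph ω₀).Reachable o a from hoa).trans (show (openGraph ω₀).Reachable a c from hac))
    have hFc := detConfig_mem_of_champion w hw A
      (fun a => (openConn a c : Set (BondConfig (Fin n)))ᶜ) a₁ a ha hac hch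
    have hY : ω₀ ∈ ((openConn a₁ c : Set (BondConfig (Fin n)))ᶜ ∩ ⋃ a ∈ A, openConn o a) := ⟨hFc, hU⟩
    rw [prodBernoulli_real_eq_one_of_detConfig_mem w hw (hmeas _) hY]
    exact measureReal_le_one
  · rw [prodBernoulli_real_eq_zero_of_detConfig_notMem w hw hX]
    exact measureReal_nonneg

/-- **(U₁) at tied worst relays implies (U₁)** (`stub_worstRelayGluing`): the worst-relay gluing inequality for a
least `c`-reliable relay `a₁` that is TIED with another relay implies it for every least reliable relay. -/
theorem worstRelayGluing_of_tied
    (hT : ∀ (n : ℕ) (w : Sym2 (Fin n) → unitInterval) (A : Finset (Fin n)) (o c a₁ : Fin n), a₁ ∈ A →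
      (∀ a ∈ A, (prodBernoulli w).real (openConn a c : Set (BondConfig (Fin n)))ᶜ ≤
        (prodBernoulli w).real (openConn a₁ c : Set (BondConfig (Fin n)))ᶜ) →
      (∃ a ∈ A, a ≠ a₁ ∧ (prodBernoulli w).real (openConn a c : Set (BondConfig (Fin n)))ᶜ =
        (prodBernoulli w).real (openConn a₁ c : Set (BondConfig (Fin n)))ᶜ) →
      (prodBernoulli w).real ((openConn o c : Set (BondConfig (Fin n)))ᶜ ∩ ⋃ a ∈ A, openConn o a) ≤
        (prodBernoulli w).real ((openConn a₁ c : Set (BondConfig (Fin n)))ᶜ ∩ ⋃ a ∈ A, openConn o a)) :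
    ∀ (n : ℕ) (w : Sym2 (Fin n) → unitInterval) (A : Finset (Fin n)) (o c a₁ : Fin n), a₁ ∈ A →
      (∀ a ∈ A, (Literature.Probability.LatticeModels.prodBernoulli w).real
          (Literature.Probability.Percolation.openConn a c :
            Set (Literature.Probability.Percolation.BondConfig (Fin n)))ᶜ ≤
        (Literature.Probability.LatticeModels.prodBernoulli w).real
          (Literature.Probability.Percolation.openConn a₁ c :
            Set (Literature.Probability.Percolation.BondConfig (Fin n)))ᶜ) →
      (Literature.Probability.LatticeModels.prodBernoulli w).real
          ((Literature.Probability.Percolation.openConn o c :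
              Set (Literature.Probability.Percolation.BondConfig (Fin n)))ᶜ ∩
            ⋃ a ∈ A, Literature.Probability.Percolation.openConn o a) ≤
        (Literature.Probability.LatticeModels.prodBernoulli w).real
          ((Literature.Probability.Percolation.openConn a₁ c :
              Set (Literature.Probability.Percolation.BondConfig (Fin n)))ᶜ ∩
            ⋃ a ∈ A, Literature.Probability.Percolation.openConn o a) := by
  intro n w A o c a₁ ha₁ hch
  exact TieReduction.le_of_tied_events A (fun a => (openConn a c : Set (BondConfig (Fin n)))ᶜ)
    ((openConn o c : Set (BondConfig (Fin n)))ᶜ ∩ ⋃ a ∈ A, openConn o a)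
    ((openConn a₁ c : Set (BondConfig (Fin n)))ᶜ ∩ ⋃ a ∈ A, openConn o a) a₁
    (fun w' hw' hch' => worstRelayGluing_zeroOne w' hw' A o c a₁ hch')
    (fun w' hch' htie' => hT n w' A o c a₁ ha₁ hch' htie') w hch

/-- **(U₁) at tied worst relays closes the crux `NoHeavyLowerTail`** (through the landed
`WorstRelayGluing.noHeavyLowerTail_of_worstRelayGluing`). -/
theorem noHeavyLowerTail_of_tiedWorstRelayGluing
    (hT : ∀ (n : ℕ) (w : Sym2 (Fin n) → unitInterval) (A : Finset (Fin n)) (o c a₁ : Fin n), a₁ ∈ A →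
      (∀ a ∈ A, (prodBernoulli w).real (openConn a c : Set (BondConfig (Fin n)))ᶜ ≤
        (prodBernoulli w).real (openConn a₁ c : Set (BondConfig (Fin n)))ᶜ) →
      (∃ a ∈ A, a ≠ a₁ ∧ (prodBernoulli w).real (openConn a c : Set (BondConfig (Fin n)))ᶜ =
        (prodBernoulli w).real (openConn a₁ c : Set (BondConfig (Fin n)))ᶜ) →
      (prodBernoulli w).real ((openConn o c : Set (BondConfig (Fin n)))ᶜ ∩ ⋃ a ∈ A, openConn o a) ≤
        (prodBernoulli w).real ((openConn a₁ c : Set (BondConfig (Fin n)))ᶜ ∩ ⋃ a ∈ A, openConn o a)) :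
    Summit.CriticalPhenomena.PercolationContinuityZ3.Theses.PercNearOneGluing.NoHeavyLowerTail :=
  WorstRelayGluing.noHeavyLowerTail_of_worstRelayGluing (worstRelayGluing_of_tied hT)

/-- **(U₁) at tied worst relays also closes the sibling crux `AdditiveGluing`** (stmt-CriticalPhenomena-4576), through
the landed `WorstRelayGluing.additiveGluing_of_worstRelayGluing`. -/
theorem additiveGluing_of_tiedWorstRelayGluing
    (hT : ∀ (n : ℕ) (w : Sym2 (Fin n) → unitInterval) (A : Finset (Fin n)) (o c a₁ : Fin n), a₁ ∈ A →
      (∀ a ∈ A, (prodBernoulli w).real (openConn a c : Set (BondConfig (Fin n)))ᶜ ≤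
        (prodBernoulli w).real (openConn a₁ c : Set (BondConfig (Fin n)))ᶜ) →
      (∃ a ∈ A, a ≠ a₁ ∧ (prodBernoulli w).real (openConn a c : Set (BondConfig (Fin n)))ᶜ =
        (prodBernoulli w).real (openConn a₁ c : Set (BondConfig (Fin n)))ᶜ) →
      (prodBernoulli w).real ((openConn o c : Set (BondConfig (Fin n)))ᶜ ∩ ⋃ a ∈ A, openConn o a) ≤
        (prodBernoulli w).real ((openConn a₁ c : Set (BondConfig (Fin n)))ᶜ ∩ ⋃ a ∈ A, openConn o a)) :
    Summit.CriticalPhenomena.PercolationContinuityZ3.Theses.PercNearOneGluing.AdditiveGluing :=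
  WorstRelayGluing.additiveGluing_of_worstRelayGluing (worstRelayGluing_of_tied hT)

end Summit.CriticalPhenomena.PercolationContinuityZ3.Theorems

end
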